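import Literature.Barriers.RiemannHypothesis.EpsteinZetaRealZerosPairGrouping
import HarnessLib

/-!
# Low's grouping for `d = 267`: `L(σ, χ_{−d}) > 0` on `(0, 1)` by pairing the principal class

Barrier audit (D-0021) of `Literature.Barriers.RiemannHypothesis.EpsteinZetaRealZeros`, continued
(generation 9, 2026-08-27): instances of `EpsteinZetaRealZerosPairGrouping.lean`. Everything here is
PROVED (theorems only).

* `d = 267` (`h(−267) = 2`, reduced classes `(1, 1, 67)`, `(3, 3, 23)`; heights
  `√267/2 = 8.170…` and `√267/6 = 2.723…`): `keyIneq_267`, `re_Λ_pair_neg_267`,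
  `LFunction_re_pos_of_odd_quadratic_267`, `LFunction_ne_zero_of_odd_quadratic_267`.

`d = 267` is the second wall (after `232`, `EpsteinZetaRealZerosPairGrouping232.lean`) of the
hypothesis-free wide floor below `d = 403`: the Fekete–Pólya witness scan of 2026-08-26 found
certificates for every other odd fundamental `−d` with `231 < d < 403`.

## Proof shape (per discriminant)

`keyIneq_d` is the elementary inequality of `pair_cell` on finitely many cells in `u = 2σ − 1`
(rational data `Y_i ≥ y_i`, `X_i`, `ρ` with the integer-power certificates `Y_i^k ≤ X_i^n`,
`ρ^n ≤ (1/a₂)^k` decided by `norm_num`), with an extra margin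
`δ₀` on the cells next to `u = 0` that feeds the continuity argument at `σ = ½`;
`re_Λ_pair_neg_d` combines it with the analytic core `re_Λ_add_re_Λ_lt_of_key` and
`re_add_re_neg_of_Ioo_half_one`; `LFunction_re_pos_of_odd_quadratic_d` is `LFunction_re_pos_of_pair`
with the two reduced classes written out (discriminant by `norm_num`, reducedness and primitivity by
`decide`).

## References

* [Low1968] M. E. Low, Acta Arith. 14 (1968) 117–140, Theorem 5 (via MR 38#4425).
* [Watkins2004RealZeros] M. Watkins, Math. Comp. 73 (2004) 415–423, Theorem (p. 416): no real zero
  on `(0, ∞)` for every odd real primitive character of conductor `≤ 3·10⁸` — the three characters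
  here are instances, now kernel-checked.
-/

noncomputable section

open Complex Filter Topology MeasureTheory Set HurwitzZeta
open scoped UpperHalfPlane

namespace Literature.Barriers.RiemannHypothesis

open Literature.NumberTheory.Automorphic
open Literature.NumberTheory.LFunctions.RealZeros
open Literature.NumberTheory.QuadraticFields.BinaryQuadraticForm (discr_apply)

/-- **The key inequality for `d = 267`** (heights `y₁ = √267/2`, `y₂ = √267/6`;
`M = 47/1000`, allowances `β₁ + β₂ = 37 / 2000` and the margin `δ₀ = 1 / 100` on
`u ≤ 1 / 20`), by 11 cells of `pair_cell` (tightest rational check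
`1.9163 ≤ 2`). [folklore] -/
private theorem keyIneq_267 {y₁ y₂ u : ℝ} (hy1 : y₁ = Real.sqrt 267 / 2)
    (hy2 : y₂ = Real.sqrt 267 / 6)
    (hu0 : 0 < u) (hu1 : u < 1) :
    (47 / 1000 - 1 / (1 + u) + 1 / u) * (y₁ ^ ((1 + u) / 2) + y₂ ^ ((1 + u) / 2)) +
      (47 / 1000 - 1 / (1 - u) - 1 / u +
          (37 / 2000 + if u ≤ 1 / 20 then (1 / 100 : ℝ) else 0)) *
        (y₁ ^ ((1 - u) / 2) + y₂ ^ ((1 - u) / 2)) ≤ 0 := by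
  have hS : Real.sqrt 267 ≤ 16.34015 := by
    rw [Real.sqrt_le_left (by norm_num)]; norm_num
  have hS' : (16.34 : ℝ) ≤ Real.sqrt 267 := by
    rw [Real.le_sqrt (by norm_num) (by norm_num)]; norm_num
  have hy2one : 1 ≤ y₂ := by rw [hy2, le_div_iff₀ (by norm_num)]; linarith
  have h12 : y₂ ≤ y₁ := by
    rw [hy1, hy2]; exact div_le_div_of_nonneg_left (Real.sqrt_nonneg _) (by norm_num) (by norm_num)
  have hr : y₂ = (1 / 3 : ℝ) * y₁ := by rw [hy1, hy2]; ring
  have hY1 : y₁ ≤ 8.170075 := by rw [hy1]; linarith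
  have hY2 : y₂ ≤ 2.72337 := by rw [hy2, div_le_iff₀ (by norm_num)]; linarith
  have cell : ∀ (p q X₁ X₂ ρ β : ℝ) (kq nq ke ne : ℕ), nq ≠ 0 → q * nq = kq →
      (8.170075 : ℝ) ^ kq ≤ X₁ ^ nq → (2.72337 : ℝ) ^ kq ≤ X₂ ^ nq → 0 ≤ X₂ → X₂ ≤ X₁ →
      0 < ρ → ne ≠ 0 → (1 - p) / 2 * ne = ke → ρ ^ ne ≤ (1 / 3 : ℝ) ^ ke →
      p ≤ u → u ≤ q → 0 ≤ β →
      (1 - p) * (((X₁ + ρ * X₂) / (1 + ρ) - 1) / q +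
        (1 + q) * (47 / 1000 * ((X₁ + ρ * X₂) / (1 + ρ) + 1) + β)) ≤ 2 →
      (47 / 1000 - 1 / (1 + u) + 1 / u) * (y₁ ^ ((1 + u) / 2) + y₂ ^ ((1 + u) / 2)) +
        (47 / 1000 - 1 / (1 - u) - 1 / u + β) * (y₁ ^ ((1 - u) / 2) + y₂ ^ ((1 - u) / 2)) ≤
          0 :=
    fun p q X₁ X₂ ρ β kq nq ke ne hnq hq' hX1 hX2 hX20 hX21 hρ0 hne he hρ hp hq hβ hc =>
      pair_cell hy2one h12 hr (by norm_num) hY1 hY2 hnq hq' hX1 hX2 hX20 hX21 hρ0 hne he hρ hp hu0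
        hq hu1 (by norm_num) hβ hc
  split_ifs with hδ
  · -- `u ≤ 1 / 20`: the cells carrying the margin `δ₀`
    exact cell (0) (1 / 20) 1.1109 1.0515 0.5772 (37 / 2000 + 1 / 100) 1 20 1 2
        (by norm_num) (by norm_num) (by norm_num) (by norm_num) (by norm_num) (by norm_num)
        (by norm_num) (by norm_num) (by norm_num) (by norm_num) hu0.le hδ (by norm_num) (by norm_num)
  · -- `1 / 20 < u < 1`
    have hδ' : (1 / 20 : ℝ) < u := lt_of_not_ge hδ
    rcases le_or_gt u (1 / 10) with hc0 | hc0
    · exact cell (1 / 20) (1 / 10) 1.2339 1.1055 0.5933 (37 / 2000 + 0) 1 10 19 40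
        (by norm_num) (by norm_num) (by norm_num) (by norm_num) (by norm_num) (by norm_num)
        (by norm_num) (by norm_num) (by norm_num) (by norm_num) hδ'.le hc0 (by norm_num) (by norm_num)
    rcases le_or_gt u (3 / 20) with hc1 | hc1
    · exact cell (1 / 10) (3 / 20) 1.3705 1.1623 0.6098 (37 / 2000 + 0) 3 20 9 20
        (by norm_num) (by norm_num) (by norm_num) (by norm_num) (by norm_num) (by norm_num)
        (by norm_num) (by norm_num) (by norm_num) (by norm_num) hc0.le hc1 (by norm_num) (by norm_num)
    rcases le_or_gt u (1 / 5) with hc2 | hc2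
    · exact cell (3 / 20) (1 / 5) 1.5223 1.222 0.6268 (37 / 2000 + 0) 1 5 17 40
        (by norm_num) (by norm_num) (by norm_num) (by norm_num) (by norm_num) (by norm_num)
        (by norm_num) (by norm_num) (by norm_num) (by norm_num) hc1.le hc2 (by norm_num) (by norm_num)
    rcases le_or_gt u (1 / 4) with hc3 | hc3
    · exact cell (1 / 5) (1 / 4) 1.6908 1.2848 0.6442 (37 / 2000 + 0) 1 4 2 5
        (by norm_num) (by norm_num) (by norm_num) (by norm_num) (by norm_num) (by norm_num)
        (by norm_num) (by norm_num) (by norm_num) (by norm_num) hc2.le hc3 (by norm_num) (by norm_num)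
    rcases le_or_gt u (3 / 10) with hc4 | hc4
    · exact cell (1 / 4) (3 / 10) 1.878 1.3508 0.6622 (37 / 2000 + 0) 3 10 3 8
        (by norm_num) (by norm_num) (by norm_num) (by norm_num) (by norm_num) (by norm_num)
        (by norm_num) (by norm_num) (by norm_num) (by norm_num) hc3.le hc4 (by norm_num) (by norm_num)
    rcases le_or_gt u (2 / 5) with hc5 | hc5
    · exact cell (3 / 10) (2 / 5) 2.317 1.4931 0.6806 (37 / 2000 + 0) 2 5 7 20
        (by norm_num) (by norm_num) (by norm_num) (by norm_num) (by norm_num) (by norm_num)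
        (by norm_num) (by norm_num) (by norm_num) (by norm_num) hc4.le hc5 (by norm_num) (by norm_num)
    rcases le_or_gt u (1 / 2) with hc6 | hc6
    · exact cell (2 / 5) (1 / 2) 2.8585 1.6504 0.7191 (37 / 2000 + 0) 1 2 3 10
        (by norm_num) (by norm_num) (by norm_num) (by norm_num) (by norm_num) (by norm_num)
        (by norm_num) (by norm_num) (by norm_num) (by norm_num) hc5.le hc6 (by norm_num) (by norm_num)
    rcases le_or_gt u (13 / 20) with hc7 | hc7
    · exact cell (1 / 2) (13 / 20) 3.9171 1.918 0.7597 (37 / 2000 + 0) 13 20 1 4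
        (by norm_num) (by norm_num) (by norm_num) (by norm_num) (by norm_num) (by norm_num)
        (by norm_num) (by norm_num) (by norm_num) (by norm_num) hc6.le hc7 (by norm_num) (by norm_num)
    rcases le_or_gt u (17 / 20) with hc8 | hc8
    · exact cell (13 / 20) (17 / 20) 5.9622 2.3435 0.8249 (37 / 2000 + 0) 17 20 7 40
        (by norm_num) (by norm_num) (by norm_num) (by norm_num) (by norm_num) (by norm_num)
        (by norm_num) (by norm_num) (by norm_num) (by norm_num) hc7.le hc8 (by norm_num) (by norm_num)
    exact cell (17 / 20) (1) 8.170075 2.72337 0.9208 (37 / 2000 + 0) 1 1 3 40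
        (by norm_num) (by norm_num) (by norm_num) (by norm_num) (by norm_num) (by norm_num)
        (by norm_num) (by norm_num) (by norm_num) (by norm_num) hc8.le hu1.le (by norm_num) (by norm_num)

/-- **`Re Λ_{z₁}(σ) + Re Λ_{z₂}(σ) < 0` on `(0, 1)` for the two classes of discriminant `−267`**
(`Im z₁ = √267/2`, the principal class, whose own `Λ` is positive near `σ = ½`;
`Im z₂ = √267/6`). [cite: Low1968, Theorem 5 (via MR 38#4425)] -/
theorem re_Λ_pair_neg_267 (z₁ z₂ : ℍ) (h1 : z₁.im = Real.sqrt 267 / 2)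
    (h2 : z₂.im = Real.sqrt 267 / 6) {σ : ℝ} (hσ0 : 0 < σ) (hσ1 : σ < 1) :
    ((thetaFEPair z₁).Λ σ).re + ((thetaFEPair z₂).Λ σ).re < 0 := by
  have hS : Real.sqrt 267 ≤ 16.34015 := by
    rw [Real.sqrt_le_left (by norm_num)]; norm_num
  have hS' : (16.34 : ℝ) ≤ Real.sqrt 267 := by
    rw [Real.le_sqrt (by norm_num) (by norm_num)]; norm_num
  have hy2 : 1 ≤ z₂.im := by rw [h2, le_div_iff₀ (by norm_num)]; linarith
  have h21 : z₂.im ≤ z₁.im := by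
    rw [h1, h2]; exact div_le_div_of_nonneg_left (Real.sqrt_nonneg _) (by norm_num) (by norm_num)
  have hE1 : 48 * Real.sqrt z₁.im * Real.exp (-(7 / 5) * Real.pi * z₁.im) ≤ 2 * (1 / 1000) :=
    bessel_allowance_of_three_le (by rw [h1]; linarith) (by rw [h1]; linarith)
  have hE2 : 48 * Real.sqrt z₂.im * Real.exp (-(7 / 5) * Real.pi * z₂.im) ≤ 2 * (7 / 400) := by
    have h := smallK_bessel_allowance (y := z₂.im) hy2 (by rw [h2]; linarith)
    have hn2 : ¬ z₂.im ≤ 2 := by rw [h2, not_le, lt_div_iff₀ (by norm_num)]; linarith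
    have h3 : z₂.im ≤ 3 := by rw [h2, div_le_iff₀ (by norm_num)]; linarith
    rw [if_neg hn2, if_pos h3] at h
    exact h
  -- the margin on `(½, 1)`, uniform near `½`
  have hmain : ∀ τ : ℝ, 1 / 2 < τ → τ < 1 → ((thetaFEPair z₁).Λ τ).re + ((thetaFEPair z₂).Λ τ).re <
      -(4 * (if 2 * τ - 1 ≤ (1 / 20 : ℝ) then (1 / 100 : ℝ) else 0)) := by
    intro τ hτ hτ1
    have hu0 : 0 < 2 * τ - 1 := by linarith
    have hu1 : 2 * τ - 1 < 1 := by linarith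
    have hk := keyIneq_267 h1 h2 hu0 hu1
    rw [show (1 + (2 * τ - 1)) / 2 = τ by ring, show (1 - (2 * τ - 1)) / 2 = 1 - τ by ring] at hk
    refine re_Λ_add_re_Λ_lt_of_key z₁ z₂ hy2 h21 hτ hτ1 (β₁ := 1 / 1000) (β₂ := 7 / 400)
      (by norm_num) (by norm_num) (by split_ifs <;> norm_num) hE1 hE2 ?_
    convert hk using 3; ring
  refine re_add_re_neg_of_Ioo_half_one z₁ z₂ (c := 4 * (1 / 100 : ℝ)) (ε := 1 / 40)
    (by norm_num) (by norm_num) (fun τ hτ hτ1 => ?_) (fun τ hτ hτ1 => ?_) hσ0 hσ1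
  · have h := hmain τ hτ hτ1
    have h0 : (0 : ℝ) ≤ 4 * (if 2 * τ - 1 ≤ (1 / 20 : ℝ) then (1 / 100 : ℝ) else 0) := by
      split_ifs <;> norm_num
    linarith
  · have h := hmain τ hτ (by linarith)
    rw [if_pos (by linarith)] at h
    exact h.le

/-- **`Re L(σ, χ) > 0` on all of `(0, 1)` for the odd real primitive character mod `267`**
(`h(−267) = 2`, reduced classes `(1, 1, 67)` and `(3, 3, 23)`; no Fekete–Pólya certificate of
order `≤ 24` and modulus `≤ 3·10⁶` exists for this character): Low's grouping of the principal
class with the class `(3, 3, 23)`. In particular `L(s, χ_{−267})` has no real zero in `(0, 1)`.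
[cite: Watkins2004RealZeros, Theorem (p. 416)] -/
theorem LFunction_re_pos_of_odd_quadratic_267 {χ : DirichletCharacter ℂ 267} (hprim : χ.IsPrimitive)
    (hquad : χ.IsQuadratic) (hodd : χ.Odd) {σ : ℝ} (hσ0 : 0 < σ) (hσ1 : σ < 1) :
    0 < (χ.LFunction σ).re := by
  refine LFunction_re_pos_of_pair (d := 267) (b₁ := 1) (c₁ := 67) (a₂ := 3) (b₂ := 3)
    (c₂ := 23) (by norm_num) (by norm_num) hprim hquad hodd (by rw [discr_apply]; norm_num)
    (by decide) (by rw [discr_apply]; norm_num) (by decide) (by decide) (by norm_num) ?_ hσ0 hσ1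
  intro Z₁ Z₂ hZ1 hZ2 τ hτ0 hτ1
  push_cast at hZ1 hZ2
  refine pair_re_neg_of_Λ (a₁ := 1) (b₁ := 1) (c₁ := 67) (a₂ := 3) (b₂ := 3) (c₂ := 23)
    ⟨by norm_num, by norm_num⟩ ⟨by norm_num, by norm_num⟩ (by norm_num) ?_ hZ1 hZ2 hτ0 hτ1
  intro z₁ z₂ hz1 hz2 σ' hσ'0 hσ'1
  have e1 : z₁.im = Real.sqrt 267 / 2 := by rw [hz1, starkK]; norm_num
  have e2 : z₂.im = Real.sqrt 267 / 6 := by rw [hz2, starkK]; norm_num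
  exact re_Λ_pair_neg_267 z₁ z₂ e1 e2 hσ'0 hσ'1

/-- **No real zero of `L(s, χ_{−267})` in `(0, 1)`.** [cite: Watkins2004RealZeros, Theorem (p. 416)] -/
theorem LFunction_ne_zero_of_odd_quadratic_267 {χ : DirichletCharacter ℂ 267} (hprim : χ.IsPrimitive)
    (hquad : χ.IsQuadratic) (hodd : χ.Odd) {σ : ℝ} (hσ0 : 0 < σ) (hσ1 : σ < 1) :
    χ.LFunction σ ≠ 0 := by
  intro h0
  have h := LFunction_re_pos_of_odd_quadratic_267 hprim hquad hodd hσ0 hσ1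
  rw [h0, Complex.zero_re] at h
  exact lt_irrefl _ h

end Literature.Barriers.RiemannHypothesis
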